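import Summits.CriticalPhenomena.PercolationContinuityZ3.Theorems.SahiMasterFamilyWingCore
import HarnessLib

/-!
# Minor domination (`MD₃`) for increasing triples in the WING class — sections of `…WingCore`

Unit `prim-master-conj` (crux anchor stmt-CriticalPhenomena-4575, helper work), gen 31; memo `run/shared/lean/prim/prim-l12/prim-master-conj/POINTWISE.md` §31.9 / §32.
`sahiE_le_mixC2_of_wingCore` applied to the `e`-sections of an increasing triple `U` with the class containments between `U_i^{e←0}` and `U_j^{e←1}`:
`Λ_e(U) ≥ 0`, hence (gen 19's `sahiE_three_ge_sq_minors_of_mixC2_ge`) `(1−p_e)²E₃(U^{e←0}) + p_e²E₃(U^{e←1}) ≤ E₃(U)`, and the settledness transfer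
(C₃ passes up from the two minors, zeros pass down). [this work]
-/

noncomputable section

open scoped Classical

namespace Summit.CriticalPhenomena.PercolationContinuityZ3.Theorems

open Finset Function
open Literature.Combinatorics.Sahi2008
open Literature.Probability.Percolation.DecisionTree (ind)
open SahiCombMix

namespace Pointwise

variable {ι : Type} [Fintype ι]

/-! ### Sections of an increasing triple: minor domination on the class Wing -/

section Sections

variable (p : ι → unitInterval) (e : ι) (U : Fin 3 → Set (Set ι)) (hU : ∀ j, IsUpperSet (U j))
  (h02 : secAt e false (U 0) ⊆ secAt e true (U 2))
  (h20 : secAt e false (U 2) ⊆ secAt e true (U 0))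
  (h01 : secAt e false (U 0) ⊆ secAt e true (U 1))
include hU h02 h20 h01

/-- **`Λ_e(U) ≥ 0` and `MD₃` on the class Wing**: for an increasing triple `U` with `U_0^{e←0} ⊆ U_2^{e←1}`, `U_2^{e←0} ⊆ U_0^{e←1}`, `U_0^{e←0} ⊆ U_1^{e←1}`:
(i) `Λ_e(U) ≥ 0` (`sahiE_le_mixC2_of_wingCore` for the sections) and (ii) hence, by gen 19's `sahiE_three_ge_sq_minors_of_mixC2_ge`,
minor domination with the explicit constants `(1−p_e)², p_e²`. [this work] -/
theorem lam_nonneg_and_minorDomination_of_wingCore :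
    (sahiE (bernoulliWeight p) 3 (fun j => ind (secAt e true (U j))) - mixC2 (bernoulliWeight p) (fun j => secAt e false (U j)) (fun j => secAt e true (U j)) ≤ 0) ∧
      ((p e : ℝ) ^ 2 * sahiE (bernoulliWeight p) 3 (fun j => ind (secAt e true (U j))) + (1 - (p e : ℝ)) ^ 2 * sahiE (bernoulliWeight p) 3 (fun j => ind (secAt e false (U j))) - sahiE (bernoulliWeight p) 3 (fun j => ind (U j)) ≤ 0) := by
  have hΛ := sahiE_le_mixC2_of_wingCore p (fun j => secAt e false (U j)) (fun j => secAt e true (U j))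
      (fun j => isUpperSet_secAt e true (hU j)) (fun j => isUpperSet_secAt e false (hU j))
      (fun j => RigidityAll.secAt_false_subset_secAt_true e (hU j)) h02 h20 h01
  have hΛ' : sahiE (bernoulliWeight p) 3 (fun j => ind (secAt e true (U j))) ≤ mixC2 (bernoulliWeight p) (fun j => secAt e false (U j)) (fun j => secAt e true (U j)) := by
    linarith only [hΛ]
  have hMD := sahiE_three_ge_sq_minors_of_mixC2_ge e U hU p hΛ'
  refine ⟨hΛ, ?_⟩
  linarith only [hMD]

/-- **Settledness transfer on the class Wing**: given both `e`-minors `≥ 0`: `E₃(μ_p;U) ≥ 0`; and if `E₃(μ_p;U) = 0` then the `1`-minor vanishes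
when `p_e ≠ 0` and the `0`-minor vanishes when `p_e ≠ 1`. [this work] -/
theorem minors_transfer_of_wingCore
    (h0 : 0 ≤ sahiE (bernoulliWeight p) 3 (fun j => ind (secAt e false (U j))))
    (h1 : 0 ≤ sahiE (bernoulliWeight p) 3 (fun j => ind (secAt e true (U j)))) :
    (0 ≤ sahiE (bernoulliWeight p) 3 (fun j => ind (U j)) ∧ ((p e : ℝ) ≠ 0 → sahiE (bernoulliWeight p) 3 (fun j => ind (U j)) = 0 → sahiE (bernoulliWeight p) 3 (fun j => ind (secAt e true (U j))) = 0)) ∧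
      ((p e : ℝ) ≠ 1 → sahiE (bernoulliWeight p) 3 (fun j => ind (U j)) = 0 → sahiE (bernoulliWeight p) 3 (fun j => ind (secAt e false (U j))) = 0) := by
  have h' := (lam_nonneg_and_minorDomination_of_wingCore p e U hU h02 h20 h01).2
  have h : (1 - (p e : ℝ)) ^ 2 * sahiE (bernoulliWeight p) 3 (fun j => ind (secAt e false (U j))) + (p e : ℝ) ^ 2 * sahiE (bernoulliWeight p) 3 (fun j => ind (secAt e true (U j))) ≤ sahiE (bernoulliWeight p) 3 (fun j => ind (U j)) := by
    linarith only [h']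
  have a0 := mul_nonneg (sq_nonneg (1 - (p e : ℝ))) h0
  have a1 := mul_nonneg (sq_nonneg (p e : ℝ)) h1
  refine ⟨⟨by linarith, fun hpe hE => ?_⟩, fun hpe hE => ?_⟩
  · rw [hE] at h
    have hsq : 0 < (p e : ℝ) ^ 2 := by positivity
    have hz : (p e : ℝ) ^ 2 * sahiE (bernoulliWeight p) 3 (fun j => ind (secAt e true (U j))) = 0 := by linarith
    rcases mul_eq_zero.1 hz with h'' | h''
    · exact absurd h'' (ne_of_gt hsq)
    · exact h''
  · rw [hE] at h
    have hne : (1 - (p e : ℝ)) ≠ 0 := sub_ne_zero.2 (Ne.symm hpe)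
    have hsq : 0 < (1 - (p e : ℝ)) ^ 2 := by positivity
    have hz : (1 - (p e : ℝ)) ^ 2 * sahiE (bernoulliWeight p) 3 (fun j => ind (secAt e false (U j))) = 0 := by linarith
    rcases mul_eq_zero.1 hz with h'' | h''
    · exact absurd h'' (ne_of_gt hsq)
    · exact h''

end Sections

end Pointwise

end Summit.CriticalPhenomena.PercolationContinuityZ3.Theorems
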